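import Literature.MathematicalPhysics.QuantumFieldTheory.Balaban1983to89.B4Prop31TorusTransfer
import Literature.MathematicalPhysics.QuantumFieldTheory.Balaban1983to89.B4Prop23TorusFamily

/-!
# `Balaban1983to89.B4Prop31TorusFamily` — [Balaban1983RegularityDecay] «Proposition 3.1′ of [2]» (1.21)–(1.22)
# p. 574 ON TORUS REGIONS `Ω ⊂ T_η` (sums of unit blocks, the whole torus included) AT A (1.21)-REGULAR TORUS FIELD
# `A ≠ 0`: the torus form family `torusFormSetting`, (1.22) on it from p35's lattice theorem read on two fundamental
# domains, the typed leaf `B4.Prop31Printed (torusFormSetting …)`, its non-vacuity, and the b4 leaf 4-tuple with ALL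
# THREE η-level families on the torus

statement-level skeleton of published theorems with citation tags; proofs where landed; nothing here is a claim about
the Yang–Mills mass gap

CITATION HEADER.  T. Bałaban, *Regularity and decay of lattice Green's functions*, Commun. Math. Phys. **89** (1983)
571–597, doi:10.1007/bf01214744 [Balaban1983RegularityDecay] (cell paper B4; held text
`paper:balaban1983-cmp89-regularity-decay`, journal page = PDF page + 570; p. 572 (1.1)–(1.7) «operators on subsets of a
torus T_η», p. 573 (1.14), p. 574 (1.21)–(1.22)).  Cell `pub-ymgap`, Track-A seat `pub-ymgap-dag-n01-b` gen 0 (node N01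
of YM-PLAN §2: the famF twin of row N01's located flag F-torusU — cross-read XREAD-B4 v0.5 §7 scope (f1): p35's
`B4Prop31Regular.prop31Printed_regularRegion` proves the typed «Proposition 3.1′ of [2]» for EVERY (1.21)-regular `A ≠ 0`
on finite unions of unit blocks of `ηℤ^{d+1}`, NOT on regions of the torus, the print's «common case» p. 572; dag-p3 g2's
torus leaf `B4Prop23TorusFamily.leafNN_torusPairFam_torusU` keeps «p35's lattice form family, unchanged» as conjunct 3).
File 2 of 2 over `B4Prop31TorusTransfer` (file 1: the transfer lemmas).  DICTIONARY `def`s WITH BODIES (`TorusFormInstance`,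
`tcovDiffSq`, `torusFormSetting`, `shiftField`, `chart₀`, `chart₁`) + theorems; no `Prop`-valued fact, no `sorry`, axioms
standard.  USED BY NAME: everything of file 1's header, p35's `B4Prop31Regular.{RegularFormInstance, regularFormSetting,
prop31Printed_regularRegion}` and `B4Prop31Charts.covDiffSq`, r01 g9 `B4ThmTorusPairEta.thmPrintedNN_torusPairFam`, dag-p3
g2 `B4Prop23TorusFamily.{torusFieldRegionsW, prop23Printed_torusRegionsW}`, pv23 `B4Sect5Proof.sect5ThmUniform_holds`.

WHAT IS PRINTED (p. 574 [PDF 4], verbatim).  «Proposition 3.1′ of [2]: Let Ω be a sum of unit blocks (i.e. Ω^{(k)} is an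
arbitrary subset of Z^d) and let A satisfies the condition |(∂^η_μA)(x)| ≤ O(1)p(e) (p(e) = a₀(1 + log e^{−1})^p), (1.21)
then there exists a positive constant γ₀ depending on d only, such that for e sufficiently small
⟨φ, Δ^{(k)}(Ω,A)φ⟩ ≥ γ₀(Σ_{⟨x,x′⟩⊂Ω^{(k)}}|U(A(⟨x,x′⟩))φ(x′) − φ(x)|² + m²Σ_{x∈Ω^{(k)}}|φ(x)|²) − O(1)e^{2−α}Σ_{x∈Ω^{(k)}}|φ(x)|²
(1.22) for arbitrary α > 0 and a constant O(1) depending on α and the other constants, but independent of Ω, k, A, and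
for an arbitrary function φ.»; p. 572 [PDF 2]: «Another common case is to consider operators on subsets of a torus T_η
which we identify with a rectangular parallelepiped in ηZ^d with periodic conditions.»  The downstream uses of (1.22)
([B4] §5 (5.2)–(5.3) for «Prop. 2.3 of [1]» on `T_η`; [B5]/[B6] on the tori `T^{(k)}`) read it on torus regions.

DICTIONARY (lattice units; as file 1, r01 g9, p35).  A TORUS INSTANCE `i` = (mesh `n ≥ 1`; the unit torus
`Π_ν ℤ/P_ν`, `P_ν ≥ 2`, fine period `nP_ν ≥ 3`; the unit labels `Ω_T ⊆ boxDom P` of `Ω` — «Ω a sum of unit blocks»,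
`Ω = T_η` when `Ω_T = boxDom P`; the charge `e`; the torus field `A_ν(x)` on the fine period box).  `torusFormSetting`:
`Cfg` = `φ : Ω^{(k)} → ℝ^N`; `reg121` = (1.21) with TORUS forward differences `|A_ν(x + ηe_μ mod T) − A_ν(x)| ≤ O(1)p(e)`
(lattice units: `/n`; r01's convention for (1.7) on `torusPairFam`); `form φ = ⟨φ, Δ^{(k)}_T(Ω,A)φ⟩` (p35's `keff` at
r01's torus data = `a − a²η^{d+1}Q_k(A)G_k(Ω,A)Q_k(A)ᵀ` with the TORUS Green's function, file 1 `keff_torus_eq`);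
`covDiffSq φ` = `tcovDiffSq` = `Σ_{⟨y,y′⟩⊂Ω^{(k)} torus bonds}|U(A(⟨y,y′⟩))φ(y′) − φ(y)|²`, the bond `⟨y, y + e_μ mod P⟩`
counted once, its link the straight fine contour of `n` steps (p35's `clink`; the wrap-around bonds INCLUDED);
`l2sq φ = Σ|φ(y)|²`.  The two charts: `chart₀ i` = p35's lattice instance `(n, Ω_T, e, A^per)` (the period box as a
fundamental domain), `chart₁ i` = the lattice instance of the torus translated by `𝟙 = (1,…,1)` unit blocks
(`shiftLabels P 𝟙 Ω_T`, field `shiftField i = A(· − n𝟙 mod T)` periodised).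

WHAT THIS MODULE PROVES (all in full).
* §1 the dictionary above; `tcovDiffSq_nonneg`.
* §2 `form_chart₀_le`, `form_chart₁_le` (file 1: `keff_region_le_torus`, `tform_shift`), `l2_chart₁`, `reg121_chart₀`,
  `reg121_chart₁` ((1.21) on the torus ⇒ (1.21) for the periodised fields of both charts), `covDiffSq_chart₀_eq`,
  `covDiffSq_chart₁_eq`, **`tcovDiffSq_le_charts`** (every torus bond is a lattice bond of one chart, file 1
  `bond_cover`: `Σ_T ≤ Σ_{chart₀} + Σ_{chart₁}`).
* §3 **`prop31Printed_torusRegions`**: `B4.Prop31Printed (torusFormSetting F a m² C a₀ p)` — the verbatim-typed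
  «Proposition 3.1′ of [2]» HOLDS ON THE TORUS FAMILY for every Lipschitz orthogonal flow, `a > 0`, `m² ≥ 0`,
  `C, a₀ ≥ 0`, `p > 0`, with `γ₀ ↦ γ₀/2`, the same threshold `e₁` and the same `C(α)` as p35's lattice theorem (two
  charts, each carrying p35's (1.22); `2⟨φ,Δ^{(k)}_Tφ⟩ ≥ γ₀(Σ₀ + Σ₁ + 2m²|φ|²) − 2C(α)e^{2−α}|φ|²`);
  `prop31Printed_torusRegions_exp` (the printed link variables `U = e^{tq}`, any antisymmetric `q`).
* §4 `torus_antecedents_met` (NON-VACUITY below every threshold: the zero field on one unit block of the torus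
  `(ℤ/3)^{d+1}`, mesh 1) and **`leafNN_torus_all`** — THE b4 LEAF 4-TUPLE WITH famE, famU AND famF ALL ON THE TORUS:
  `ThmPrintedNN (torusPairFam …) ∧ Prop23Printed (torusFieldRegionsW …) ∧ Prop31Printed (torusFormSetting …) ∧
  Sect5ThmUniform d₅ N₅` (r01 g9 · dag-p3 g2 · this file · pv23).
HONEST SCOPE.  (1) `γ₀` on the torus is HALF of p35's lattice `γ₀ = 1/max((6(d+1)+2m²)/a, 24)` (two charts) and
inherits its dependence on `(d, a, m²)` (print: «depending on d only» — p35's HONEST LABEL, unchanged); `e₁`, `C(α)` are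
p35's.  (2) The route (Neumann fundamental domains in two positions + variational monotonicity) is this lineage's
reading device, not the print's local §4 argument (which is insensitive to `ηℤ^{d+1}` vs `T_η`).  (3) `P_ν ≥ 2` and fine
period `≥ 3` are unprinted non-degeneracy conventions of the torus family (ref-C n01 read: «harmless»).  (4) No family of
record is re-pinned here: conjunct 3 of NODE 00's b4 binding stays p35's lattice famF until node00-def ∕ the leads decide
otherwise; this file only puts the torus famF in the tree.  Count-neutral for YM-PLAN (typed 28∕28 · discharged 0∕28
unmoved); nothing here concerns the continuum, ℝ⁴, OS axioms, a mass gap or the Clay problem.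
-/

namespace Literature.MathematicalPhysics.QuantumFieldTheory.Balaban1983to89.B4Prop31TorusFamily

open Matrix Finset
open Literature.MathematicalPhysics.QuantumFieldTheory.Balaban1983to89
open Literature.MathematicalPhysics.QuantumFieldTheory.Balaban1983to89.B4GaugeCovariance
open Literature.MathematicalPhysics.QuantumFieldTheory.Balaban1983to89.B4Lower18 (fineDom mem_fineDom)
open Literature.MathematicalPhysics.QuantumFieldTheory.Balaban1983to89.B4Lower18Regular (e1 e1_apply_self e1_apply_ne
  dotProduct_self_nonneg')
open Literature.MathematicalPhysics.QuantumFieldTheory.Balaban1983to89.B4Lower18RegularRegion (regWt rBlkWt rbaseEmb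
  rstairContour compField)
open Literature.MathematicalPhysics.QuantumFieldTheory.Balaban1983to89.B4Reflection242 (nbrs blk boxDom mem_boxDom)
open Literature.MathematicalPhysics.QuantumFieldTheory.Balaban1983to89.B4TorusPositivity (wrap)
open Literature.MathematicalPhysics.QuantumFieldTheory.Balaban1983to89.B4TorusRegionOp
open Literature.MathematicalPhysics.QuantumFieldTheory.Balaban1983to89.B4Prop31Energy
open Literature.MathematicalPhysics.QuantumFieldTheory.Balaban1983to89.B4Prop31Holonomy (clink)
open Literature.MathematicalPhysics.QuantumFieldTheory.Balaban1983to89.B4Prop31Charts (linkR transR covDiffSq)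
open Literature.MathematicalPhysics.QuantumFieldTheory.Balaban1983to89.B4Prop31Regular (RegularFormInstance
  regularFormSetting prop31Printed_regularRegion)
open Literature.MathematicalPhysics.QuantumFieldTheory.Balaban1983to89.B2Lemma24KerOmegaTorusShift (tlab shiftLabels
  tfin σT σY σTι σYι σYquiv σTι_eq σYι_eq tlab_mem_boxDom wrap_of_mem wrap_mem_boxDom tlab_neg_tlab shiftLabels_subset
  mem_of_tlab_mem tlab_mem_shiftLabels tfin_neg_tfin tfin_twrap_add tfin_mem_perBox σT_surjective)
open Literature.MathematicalPhysics.QuantumFieldTheory.Balaban1983to89.B4Prop31TorusTransfer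
open Literature.MathematicalPhysics.QuantumFieldTheory.Balaban1983to89.B4Ineq111ZeroNestEta (ThmPrintedNN)
open Literature.MathematicalPhysics.QuantumFieldTheory.Balaban1983to89.B4TorusPairFam (torusPairFam)
open Literature.MathematicalPhysics.QuantumFieldTheory.Balaban1983to89.B4ThmRegionPairEta (Kmod)
open Literature.MathematicalPhysics.QuantumFieldTheory.Balaban1983to89.B4ThmTorusPairEta (thmPrintedNN_torusPairFam)
open Literature.MathematicalPhysics.QuantumFieldTheory.Balaban1983to89.B4Prop23TorusFamily (torusFieldRegionsW
  prop23Printed_torusRegionsW)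
open Literature.MathematicalPhysics.QuantumFieldTheory.Balaban1983to89.B4Sect5Proof (sect5ThmUniform_holds)
open Literature.MathematicalPhysics.QuantumFieldTheory.Balaban1983to89.B4Eq12ExpFlow (expFlow expFlow_ell_nonneg
  expFlow_lipschitz)

noncomputable section

variable {d : ℕ} {ι : Type} [Fintype ι] [DecidableEq ι]

/-! ## §1. Torus instances, the torus bond sum of (1.22), the torus form family -/

/-- A TORUS INSTANCE for «Proposition 3.1′ of [2]»: mesh `n ≥ 1` (`η = 1/n`); the unit torus `Π_ν ℤ/P_ν` with
`P_ν ≥ 2` unit blocks per direction and fine period `nP_ν ≥ 3`; the unit labels `Ω_T ⊆ Π_ν[0,P_ν)` of the torus region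
`Ω` («a sum of unit blocks»; `Ω_T = boxDom P` is the whole torus); the charge `e`; the torus vector field `A_ν(x)` in
component form on the fine period box — NO hypothesis on `A`, `e` (the antecedents (1.21), `0 < e ≤ e₁` live in
`B4.Prop31Printed`). [cite: Balaban1983RegularityDecay, p. 574 (1.21)–(1.22) with p. 572 «operators on subsets of a torus T_η», dictionary] -/
structure TorusFormInstance (d : ℕ) where
  /-- mesh: `η = 1/n` -/
  n : ℕ
  hn : 1 ≤ n
  /-- the unit torus: `P_ν` unit blocks in direction `ν` -/
  P : Fin (d + 1) → ℕ
  hP2 : ∀ ν, 2 ≤ P ν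
  h3 : ∀ ν, 3 ≤ per n P ν
  /-- the unit labels of `Ω` (representatives in the period box) -/
  ΩT : Finset (Fin (d + 1) → ℤ)
  hΩ : ΩT ⊆ boxDom P
  /-- the charge -/
  e : ℝ
  /-- the torus field in component form on the fine period box -/
  Ac : (Fin (d + 1) → ℤ) → Fin (d + 1) → ℝ

namespace TorusFormInstance

/-- `P_ν ≥ 1`. [cite: Balaban1983RegularityDecay, p. 572 «a torus T_η», dictionary] -/
theorem hP (i : TorusFormInstance d) : ∀ ν, 1 ≤ i.P ν := fun ν => le_trans (by norm_num) (i.hP2 ν)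

end TorusFormInstance

/-- **THE COVARIANT BOND SUM OF (1.22) ON A TORUS REGION** `Σ_{⟨y,y′⟩⊂Ω^{(k)}}|U(A(⟨y,y′⟩))φ(y′) − φ(y)|²`: over the
unit bonds `⟨y, y + e_μ mod P⟩` of the torus with both ends in `Ω^{(k)}` (each bond once, positively oriented; the
wrap-around bonds included), `U(A(⟨y, y+e_μ⟩))` = the transport along the straight fine contour of `n` steps from
`n·y` (p35's `clink`; the contour lies in `B(y)`). [cite: Balaban1983RegularityDecay, p. 574 (1.22) with p. 572 «periodic conditions»] -/
def tcovDiffSq (F : OrthFlow ι) (κ : ℝ) (Ac : (Fin (d + 1) → ℤ) → Fin (d + 1) → ℝ) (n : ℕ) (P : Fin (d + 1) → ℕ)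
    (ΩT : Finset (Fin (d + 1) → ℤ)) (ψ : ↥ΩT × ι → ℝ) : ℝ :=
  ∑ y : ↥ΩT, ∑ μ : Fin (d + 1),
    if h : wrap P (y.1 + e1 μ) ∈ ΩT then
      (clink F κ Ac n y.1 μ *ᵥ fld ψ ⟨wrap P (y.1 + e1 μ), h⟩ - fld ψ y) ⬝ᵥ
        (clink F κ Ac n y.1 μ *ᵥ fld ψ ⟨wrap P (y.1 + e1 μ), h⟩ - fld ψ y)
    else 0

/-- **THE TORUS CARRIERS OF `B4.FormSetting`** («Proposition 3.1′ of [2]» on regions of `T_η`): `Cfg := (Ω^{(k)} → ℝ^ι)`;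
`e`; `massSq := m²`; `unitBlocks := True` (`fineDom n Ω_T` IS a sum of unit blocks of the torus); `reg121 :=` (1.21)
with torus forward differences, lattice units: `|A_ν(x + e_μ mod T) − A_ν(x)| ≤ C·p(e)/n` on `Ω`,
`p(e) = a₀(1 + log e⁻¹)^p`; `form ψ := ⟨ψ, Δ^{(k)}_T(Ω,A)ψ⟩` (p35's `keff` (1.14) at r01's torus data: torus bonds,
unit-block weights, links `U(κ·A_b)` with `κ = e/n`, staircase transporters); `covDiffSq := tcovDiffSq`;
`l2sq ψ := Σ_y|ψ(y)|²`. [cite: Balaban1983RegularityDecay, p. 574 (1.21)–(1.22), p. 573 (1.14), p. 572 (1.3)–(1.6) «operators on subsets of a torus T_η», dictionary] -/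
def torusFormSetting (F : OrthFlow ι) (a m2 C a₀ p : ℝ) (i : TorusFormInstance d) : B4.FormSetting where
  Cfg := ↥i.ΩT × ι → ℝ
  e := i.e
  massSq := m2
  unitBlocks := True
  reg121 := ∀ x ∈ fineDom i.n i.ΩT, ∀ μ ν : Fin (d + 1),
    |i.Ac (twrap i.n i.P (x + e1 μ)) ν - i.Ac x ν| ≤ C * B2.pFn a₀ p i.e / i.n
  form := fun ψ => ψ ⬝ᵥ (keff (torWt i.n i.P (fineDom i.n i.ΩT)) m2 a (((i.n : ℝ) ^ (d + 1))⁻¹)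
    (rBlkWt i.n i.ΩT (fineDom i.n i.ΩT))
    (fieldLink F (i.e / i.n) fun u v : ↥(fineDom i.n i.ΩT) => torBond i.n i.P i.Ac u.1 v.1)
    (contourTrans (fieldLink F (i.e / i.n) fun u v : ↥(fineDom i.n i.ΩT) => torBond i.n i.P i.Ac u.1 v.1)
      (rbaseEmb i.hn i.ΩT) (rstairContour i.hn i.ΩT)) *ᵥ ψ)
  covDiffSq := tcovDiffSq F (i.e / i.n) i.Ac i.n i.P i.ΩT
  l2sq := fun ψ => ψ ⬝ᵥ ψ

/-- THE TRANSLATED TORUS FIELD `A′(x) = A(x − n𝟙 mod T)` (so that `A′(x + n𝟙 mod T) = A(x)` on the fine period box).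
[cite: Balaban1983RegularityDecay, p. 572 «periodic conditions», dictionary] -/
def shiftField (i : TorusFormInstance d) : (Fin (d + 1) → ℤ) → Fin (d + 1) → ℝ :=
  fun z => i.Ac (tfin i.P (-(fun _ => 1)) i.n z)

/-- CHART 0: p35's lattice instance `(n, Ω_T, e, A^per)` — the period box as a fundamental domain of the torus (Neumann
bonds of the representatives only). [cite: Balaban1983RegularityDecay, p. 572 «a rectangular parallelepiped in ηZ^d with periodic conditions», dictionary] -/
def chart₀ (i : TorusFormInstance d) : RegularFormInstance d where
  n := i.n
  hn := i.hn
  Ωc := i.ΩT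
  e := i.e
  Ac := perField i.n i.P i.Ac

/-- CHART 1: p35's lattice instance of the torus TRANSLATED BY `𝟙 = (1,…,1)` unit blocks: labels `Ω_T + 𝟙 mod P`, field
`(A′)^per`, `A′ = shiftField i`. [cite: Balaban1983RegularityDecay, p. 572 «periodic conditions», dictionary] -/
def chart₁ (i : TorusFormInstance d) : RegularFormInstance d where
  n := i.n
  hn := i.hn
  Ωc := shiftLabels i.P (fun _ => 1) i.ΩT
  e := i.e
  Ac := perField i.n i.P (shiftField i)

/-- the translated field read back: `A′(x + n𝟙 mod T) = A(x)` on the fine period box. [cite: Balaban1983RegularityDecay, p. 572 «periodic conditions», dictionary] -/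
theorem shiftField_tfin (i : TorusFormInstance d) :
    ∀ z ∈ boxDom (per i.n i.P), shiftField i (tfin i.P (fun _ => 1) i.n z) = i.Ac z := by
  intro z hz
  unfold shiftField
  rw [tfin_neg_tfin i.P _ hz]

/-- the torus bond sum is non-negative. [cite: Balaban1983RegularityDecay, p. 574 (1.22), dictionary] -/
theorem tcovDiffSq_nonneg (F : OrthFlow ι) (κ : ℝ) (Ac : (Fin (d + 1) → ℤ) → Fin (d + 1) → ℝ) (n : ℕ)
    (P : Fin (d + 1) → ℕ) (ΩT : Finset (Fin (d + 1) → ℤ)) (ψ : ↥ΩT × ι → ℝ) :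
    0 ≤ tcovDiffSq F κ Ac n P ΩT ψ := by
  unfold tcovDiffSq
  refine Finset.sum_nonneg fun y _ => Finset.sum_nonneg fun μ _ => ?_
  split_ifs
  · exact dotProduct_self_nonneg' _
  · exact le_rfl

/-! ## §2. The two charts against the torus: forms, `L²` norms, (1.21), and the bond sums -/

section Charts

variable (F : OrthFlow ι) (a m2 C a₀ p : ℝ) (i : TorusFormInstance d)

/-- **CHART 0 — THE FORM**: `⟨ψ, Δ^{(k)}_ℤ(Ω_T, A^per)ψ⟩ ≤ ⟨ψ, Δ^{(k)}_T(Ω, A)ψ⟩` (`a > 0`, `m² ≥ 0`; file 1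
`keff_region_le_torus`). [cite: Balaban1983RegularityDecay, p. 573 (1.14), p. 589 (4.1)–(4.3)] -/
theorem form_chart₀_le (ha : 0 < a) (hm : 0 ≤ m2) (ψ : ↥i.ΩT × ι → ℝ) :
    (regularFormSetting F a m2 C a₀ p (chart₀ i)).form ψ ≤ (torusFormSetting F a m2 C a₀ p i).form ψ :=
  keff_region_le_torus F i.hn i.h3 i.hΩ i.e ha hm i.Ac ψ

/-- **CHART 1 — THE FORM**: `⟨ψ∘σY⁻¹, Δ^{(k)}_ℤ(Ω_T + 𝟙, (A′)^per)(ψ∘σY⁻¹)⟩ ≤ ⟨ψ, Δ^{(k)}_T(Ω, A)ψ⟩` (file 1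
`keff_region_le_torus` at the translated torus data, then `tform_shift`). [cite: Balaban1983RegularityDecay, p. 573 (1.14), p. 589 (4.1)–(4.3), p. 572 «periodic conditions»] -/
theorem form_chart₁_le (ha : 0 < a) (hm : 0 ≤ m2) (ψ : ↥i.ΩT × ι → ℝ) :
    (regularFormSetting F a m2 C a₀ p (chart₁ i)).form (ψ ∘ (σYι ι i.P (fun _ => 1) i.hΩ i.hP).symm)
      ≤ (torusFormSetting F a m2 C a₀ p i).form ψ := by
  have h := keff_region_le_torus F i.hn i.h3 (shiftLabels_subset i.P (fun _ => 1) i.hP i.ΩT) i.e ha hm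
    (shiftField i) (ψ ∘ (σYι ι i.P (fun _ => 1) i.hΩ i.hP).symm)
  rw [tform_shift F i.hn i.P i.hP (fun _ => 1) i.hΩ i.Ac (shiftField i) (shiftField_tfin i) i.e a m2 ψ] at h
  exact h

omit [DecidableEq ι] in
/-- **CHART 1 — THE `L²` NORM**: `|ψ∘σY⁻¹|² = |ψ|²`. [cite: Balaban1983RegularityDecay, p. 574 (1.22) «Σ|φ(x)|²», dictionary] -/
theorem l2_chart₁ (ψ : ↥i.ΩT × ι → ℝ) :
    (ψ ∘ (σYι ι i.P (fun _ => 1) i.hΩ i.hP).symm) ⬝ᵥ (ψ ∘ (σYι ι i.P (fun _ => 1) i.hΩ i.hP).symm) = ψ ⬝ᵥ ψ :=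
  l2_shift i.P i.hP _ i.hΩ ψ

omit [Fintype ι] [DecidableEq ι] in
/-- **(1.21) ON THE TORUS ⇒ (1.21) FOR CHART 0**: the torus forward differences of `A` on `Ω` are the lattice forward
differences of `A^per` on the representatives. [cite: Balaban1983RegularityDecay, p. 574 (1.21), p. 572 «periodic conditions»] -/
theorem reg121_chart₀ {B : ℝ}
    (h : ∀ x ∈ fineDom i.n i.ΩT, ∀ μ ν : Fin (d + 1), |i.Ac (twrap i.n i.P (x + e1 μ)) ν - i.Ac x ν| ≤ B) :
    ∀ x ∈ fineDom i.n i.ΩT, ∀ μ ν : Fin (d + 1),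
      |perField i.n i.P i.Ac (x + e1 μ) ν - perField i.n i.P i.Ac x ν| ≤ B := by
  intro x hx μ ν
  have hxb : x ∈ boxDom (per i.n i.P) := val_mem_perBox i.hn i.hΩ ⟨x, hx⟩
  unfold perField
  rw [twrap_eq_self hxb]
  exact h x hx μ ν

omit [Fintype ι] [DecidableEq ι] in
/-- **(1.21) ON THE TORUS ⇒ (1.21) FOR CHART 1**: the lattice forward differences of `(A′)^per` on the translated
representatives are torus forward differences of `A` on `Ω`. [cite: Balaban1983RegularityDecay, p. 574 (1.21), p. 572 «periodic conditions»] -/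
theorem reg121_chart₁ {B : ℝ}
    (h : ∀ x ∈ fineDom i.n i.ΩT, ∀ μ ν : Fin (d + 1), |i.Ac (twrap i.n i.P (x + e1 μ)) ν - i.Ac x ν| ≤ B) :
    ∀ x ∈ fineDom i.n (shiftLabels i.P (fun _ => 1) i.ΩT), ∀ μ ν : Fin (d + 1),
      |perField i.n i.P (shiftField i) (x + e1 μ) ν - perField i.n i.P (shiftField i) x ν| ≤ B := by
  intro x' hx' μ ν
  obtain ⟨x, hx⟩ := σT_surjective i.P (fun _ => 1) i.hn i.hΩ i.hP ⟨x', hx'⟩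
  have hxv : tfin i.P (fun _ => 1) i.n x.1 = x' := congrArg Subtype.val hx
  have hxb : x.1 ∈ boxDom (per i.n i.P) := val_mem_perBox i.hn i.hΩ x
  have hx'b : x' ∈ boxDom (per i.n i.P) := by rw [← hxv]; exact tfin_mem_perBox i.P _ i.hn i.hP x.1
  unfold perField shiftField
  rw [twrap_eq_self hx'b, ← hxv, ← tfin_twrap_add, tfin_neg_tfin i.P _ (twrap_mem_boxDom i.hn i.hP _),
    tfin_neg_tfin i.P _ hxb]
  exact h x.1 x.2 μ ν

/-! ### The bond sums of the two charts are partial sums of the torus bond sum -/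

variable {F i}

/-- one term of the torus bond sum (the bond `⟨y, y + e_μ mod P⟩`; `0` if it leaves `Ω^{(k)}`). [cite: Balaban1983RegularityDecay, p. 574 (1.22), dictionary] -/
def bterm (F : OrthFlow ι) (i : TorusFormInstance d) (ψ : ↥i.ΩT × ι → ℝ) (y : ↥i.ΩT) (μ : Fin (d + 1)) : ℝ :=
  if h : wrap i.P (y.1 + e1 μ) ∈ i.ΩT then
    (clink F (i.e / i.n) i.Ac i.n y.1 μ *ᵥ fld ψ ⟨wrap i.P (y.1 + e1 μ), h⟩ - fld ψ y) ⬝ᵥ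
      (clink F (i.e / i.n) i.Ac i.n y.1 μ *ᵥ fld ψ ⟨wrap i.P (y.1 + e1 μ), h⟩ - fld ψ y)
  else 0

/-- the torus bond sum of the family is the sum of its bond terms. [cite: Balaban1983RegularityDecay, p. 574 (1.22), dictionary] -/
theorem covDiffSq_torus_eq (ψ : ↥i.ΩT × ι → ℝ) :
    (torusFormSetting F a m2 C a₀ p i).covDiffSq ψ = ∑ y : ↥i.ΩT, ∑ μ : Fin (d + 1), bterm F i ψ y μ := rfl

/-- a bond term is non-negative. [cite: Balaban1983RegularityDecay, p. 574 (1.22), dictionary] -/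
theorem bterm_nonneg (ψ : ↥i.ΩT × ι → ℝ) (y : ↥i.ΩT) (μ : Fin (d + 1)) : 0 ≤ bterm F i ψ y μ := by
  unfold bterm
  split_ifs
  · exact dotProduct_self_nonneg' _
  · exact le_rfl

/-- the bond term with its end-point named. [cite: Balaban1983RegularityDecay, p. 574 (1.22), dictionary] -/
theorem bterm_of_eq (ψ : ↥i.ΩT × ι → ℝ) (y : ↥i.ΩT) (μ : Fin (d + 1)) {z : Fin (d + 1) → ℤ} (hz : z ∈ i.ΩT)
    (he : wrap i.P (y.1 + e1 μ) = z) :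
    bterm F i ψ y μ = (clink F (i.e / i.n) i.Ac i.n y.1 μ *ᵥ fld ψ ⟨z, hz⟩ - fld ψ y) ⬝ᵥ
      (clink F (i.e / i.n) i.Ac i.n y.1 μ *ᵥ fld ψ ⟨z, hz⟩ - fld ψ y) := by
  subst he
  unfold bterm
  rw [dif_pos hz]

/-- **CHART 0 — THE BOND SUM**: p35's lattice bond sum of the representatives at `A^per` is the part of the torus bond
sum over the bonds that do not cross the seam of the period box. [cite: Balaban1983RegularityDecay, p. 574 (1.22), p. 572 «periodic conditions»] -/
theorem covDiffSq_chart₀_eq (ψ : ↥i.ΩT × ι → ℝ) :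
    (regularFormSetting F a m2 C a₀ p (chart₀ i)).covDiffSq ψ
      = ∑ y : ↥i.ΩT, ∑ μ : Fin (d + 1), if y.1 + e1 μ ∈ i.ΩT then bterm F i ψ y μ else 0 := by
  show covDiffSq F (i.e / i.n) (perField i.n i.P i.Ac) i.n i.ΩT ψ = _
  unfold covDiffSq
  refine Finset.sum_congr rfl fun y _ => Finset.sum_congr rfl fun μ _ => ?_
  by_cases h : y.1 + e1 μ ∈ i.ΩT
  · have hw : wrap i.P (y.1 + e1 μ) = y.1 + e1 μ := wrap_of_mem i.P (i.hΩ h)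
    rw [dif_pos h, if_pos h, bterm_of_eq ψ y μ h hw, clink_perField i.hn F (i.e / i.n) i.Ac (i.hΩ y.2) μ]
  · rw [dif_neg h, if_neg h]

omit [Fintype ι] [DecidableEq ι] in
/-- the translated field of a label: `(ψ∘σY⁻¹)(σY y) = ψ(y)`. [cite: Balaban1983RegularityDecay, p. 572 «periodic conditions», dictionary] -/
theorem fld_comp_symm_σY (ψ : ↥i.ΩT × ι → ℝ) (y : ↥i.ΩT) :
    fld (ψ ∘ (σYι ι i.P (fun _ => 1) i.hΩ i.hP).symm) (σY i.P (fun _ => 1) i.ΩT y) = fld ψ y := by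
  funext c
  show ψ ((σYι ι i.P (fun _ => 1) i.hΩ i.hP).symm ((σYι ι i.P (fun _ => 1) i.hΩ i.hP) (y, c))) = ψ (y, c)
  rw [Equiv.symm_apply_apply]

/-- **CHART 1 — THE BOND SUM**: p35's lattice bond sum of the translated representatives at `(A′)^per`, for `ψ∘σY⁻¹`, is
the part of the torus bond sum over the bonds that do not cross the seam of the translated period box.
[cite: Balaban1983RegularityDecay, p. 574 (1.22), p. 572 «periodic conditions»] -/
theorem covDiffSq_chart₁_eq (ψ : ↥i.ΩT × ι → ℝ) :
    (regularFormSetting F a m2 C a₀ p (chart₁ i)).covDiffSq (ψ ∘ (σYι ι i.P (fun _ => 1) i.hΩ i.hP).symm)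
      = ∑ y : ↥i.ΩT, ∑ μ : Fin (d + 1),
          if tlab i.P (fun _ => 1) y.1 + e1 μ ∈ shiftLabels i.P (fun _ => 1) i.ΩT then bterm F i ψ y μ else 0 := by
  set t : Fin (d + 1) → ℤ := fun _ => 1 with ht
  set ψ' := ψ ∘ (σYι ι i.P t i.hΩ i.hP).symm with hψ'
  show covDiffSq F (i.e / i.n) (perField i.n i.P (shiftField i)) i.n (shiftLabels i.P t i.ΩT) ψ' = _
  unfold covDiffSq
  rw [← Equiv.sum_comp (σYquiv i.P t i.hΩ i.hP)]
  refine Finset.sum_congr rfl fun y _ => Finset.sum_congr rfl fun μ _ => ?_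
  have hσ : (σYquiv i.P t i.hΩ i.hP) y = σY i.P t i.ΩT y := rfl
  rw [hσ]
  by_cases h : tlab i.P t y.1 + e1 μ ∈ shiftLabels i.P t i.ΩT
  · have hval : (σY i.P t i.ΩT y).1 + e1 μ = tlab i.P t y.1 + e1 μ := rfl
    have h' : (σY i.P t i.ΩT y).1 + e1 μ ∈ shiftLabels i.P t i.ΩT := by rw [hval]; exact h
    rw [dif_pos h', if_pos h]
    -- the end-point is the translate of `y + e_μ mod P`
    have hbox : tlab i.P t y.1 + e1 μ ∈ boxDom i.P := shiftLabels_subset i.P t i.hP i.ΩT h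
    have hend : tlab i.P t (wrap i.P (y.1 + e1 μ)) = tlab i.P t y.1 + e1 μ := tlab_wrap_add_e1_of_mem i.P t y.1 μ hbox
    have hw : wrap i.P (y.1 + e1 μ) ∈ i.ΩT := by
      refine mem_of_tlab_mem i.P t i.hΩ (wrap_mem_boxDom i.P i.hP _) ?_
      rw [hend]; exact h
    have hpt : (⟨(σY i.P t i.ΩT y).1 + e1 μ, h'⟩ : ↥(shiftLabels i.P t i.ΩT))
        = σY i.P t i.ΩT ⟨wrap i.P (y.1 + e1 μ), hw⟩ := Subtype.ext hend.symm
    rw [hpt, fld_comp_symm_σY ψ ⟨_, hw⟩, fld_comp_symm_σY ψ y, bterm_of_eq ψ y μ hw rfl,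
      show (σY i.P t i.ΩT y).1 = tlab i.P t y.1 from rfl,
      clink_shift i.hn i.hP F (i.e / i.n) t i.Ac (shiftField i) (shiftField_tfin i) (i.hΩ y.2) μ]
  · have h' : ¬ ((σY i.P t i.ΩT y).1 + e1 μ ∈ shiftLabels i.P t i.ΩT) := h
    rw [dif_neg h', if_neg h]

/-- **THE TORUS BOND SUM IS AT MOST THE SUM OF THE TWO CHARTS' BOND SUMS** (every torus bond is a lattice bond of
chart 0 or of chart 1, file 1 `bond_cover`; all terms are non-negative). [cite: Balaban1983RegularityDecay, p. 574 (1.22), p. 572 «periodic conditions»] -/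
theorem tcovDiffSq_le_charts (ψ : ↥i.ΩT × ι → ℝ) :
    (torusFormSetting F a m2 C a₀ p i).covDiffSq ψ
      ≤ (regularFormSetting F a m2 C a₀ p (chart₀ i)).covDiffSq ψ
        + (regularFormSetting F a m2 C a₀ p (chart₁ i)).covDiffSq (ψ ∘ (σYι ι i.P (fun _ => 1) i.hΩ i.hP).symm) := by
  rw [covDiffSq_torus_eq, covDiffSq_chart₀_eq, covDiffSq_chart₁_eq, ← Finset.sum_add_distrib]
  refine Finset.sum_le_sum fun y _ => ?_
  rw [← Finset.sum_add_distrib]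
  refine Finset.sum_le_sum fun μ _ => ?_
  have h0 := bterm_nonneg (F := F) ψ y μ
  by_cases hw : wrap i.P (y.1 + e1 μ) ∈ i.ΩT
  · rcases bond_cover i.P (i.hP2 μ) i.hP (i.hΩ y.2) with hb | hb
    · have hmem : y.1 + e1 μ ∈ i.ΩT := by rw [← wrap_of_mem i.P hb]; exact hw
      rw [if_pos hmem]
      split_ifs <;> linarith
    · have hmem : tlab i.P (fun _ => 1) y.1 + e1 μ ∈ shiftLabels i.P (fun _ => 1) i.ΩT := by
        rw [← tlab_wrap_add_e1_of_mem i.P (fun _ => 1) y.1 μ hb]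
        exact tlab_mem_shiftLabels i.P _ hw
      rw [if_pos hmem]
      split_ifs <;> linarith
  · have hz : bterm F i ψ y μ = 0 := by unfold bterm; rw [dif_neg hw]
    rw [hz]
    split_ifs <;> linarith

end Charts

/-! ## §3. «Proposition 3.1′ of [2]» on the torus family -/

section Main

variable (F : OrthFlow ι) {ℓ : ℝ} (hℓ : 0 ≤ ℓ)
  (hLip : ∀ t (v : ι → ℝ), ((F.U t - 1) *ᵥ v) ⬝ᵥ ((F.U t - 1) *ᵥ v) ≤ (ℓ * t) ^ 2 * (v ⬝ᵥ v))

include hℓ hLip in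
/-- **THEOREM («PROPOSITION 3.1′ OF [2]» TYPED, ON THE TORUS FAMILY: ALL MESHES, ALL TORI, ALL TORUS REGIONS — THE WHOLE
TORUS INCLUDED —, ALL CHARGES, ALL TORUS FIELDS `A ≠ 0`)**: for a Lipschitz orthogonal flow, `a > 0`, `m² ≥ 0`,
`C, a₀ ≥ 0`, `p > 0`, the verbatim-typed `B4.Prop31Printed` HOLDS on `torusFormSetting F a m² C a₀ p`, with `γ₀` = HALF of
p35's lattice `γ₀` and p35's `e₁`, `C(α)`.  Proof: p35's `prop31Printed_regularRegion` on the two charts (`form_chart₀_le`,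
`form_chart₁_le`, `reg121_chart₀`, `reg121_chart₁`, `l2_chart₁`) and `tcovDiffSq_le_charts`:
`2⟨φ, Δ^{(k)}_Tφ⟩ ≥ γ₀(Σ₀ + Σ₁) + 2γ₀m²|φ|² − 2C(α)e^{2−α}|φ|² ≥ γ₀(Σ_T + m²|φ|²) − 2C(α)e^{2−α}|φ|²`.  HONEST LABEL: `γ₀`
depends on `(d, a, m²)` (print: «on d only», p35's label). [cite: Balaban1983RegularityDecay, Prop. 3.1′ of [2] (1.21)–(1.22) p.574; p.572 «operators on subsets of a torus T_η»] -/
theorem prop31Printed_torusRegions {a : ℝ} (ha : 0 < a) {m2 : ℝ} (hm : 0 ≤ m2) {C : ℝ} (hC : 0 ≤ C) {a₀ : ℝ}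
    (ha₀ : 0 ≤ a₀) {p : ℝ} (hp : 0 < p) : B4.Prop31Printed (torusFormSetting (d := d) F a m2 C a₀ p) := by
  obtain ⟨γ₀, e₁, hγ₀, he₁, H⟩ := prop31Printed_regularRegion (d := d) F hℓ hLip ha hm hC ha₀ hp
  refine ⟨γ₀ / 2, e₁, half_pos hγ₀, he₁, fun α hα => ?_⟩
  obtain ⟨C', hC', H'⟩ := H α hα
  refine ⟨C', hC', ?_⟩
  intro i _ hreg he hle ψ
  change 0 < i.e at he
  change i.e ≤ e₁ at hle
  change ∀ x ∈ fineDom i.n i.ΩT, ∀ μ ν : Fin (d + 1),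
    |i.Ac (twrap i.n i.P (x + e1 μ)) ν - i.Ac x ν| ≤ C * B2.pFn a₀ p i.e / i.n at hreg
  -- p35's (1.22) on the two charts
  have h0 := H' (chart₀ i) trivial (reg121_chart₀ i hreg) he hle ψ
  have h1 := H' (chart₁ i) trivial (reg121_chart₁ i hreg) he hle (ψ ∘ (σYι ι i.P (fun _ => 1) i.hΩ i.hP).symm)
  have hf0 := form_chart₀_le F a m2 C a₀ p i ha hm ψ
  have hf1 := form_chart₁_le F a m2 C a₀ p i ha hm ψ
  have hD := tcovDiffSq_le_charts (F := F) (a := a) (m2 := m2) (C := C) (a₀ := a₀) (p := p) (i := i) ψ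
  have hl2 : (regularFormSetting F a m2 C a₀ p (chart₁ i)).l2sq (ψ ∘ (σYι ι i.P (fun _ => 1) i.hΩ i.hP).symm)
      = ψ ⬝ᵥ ψ := l2_chart₁ i ψ
  -- name the quantities
  set T := (torusFormSetting F a m2 C a₀ p i).form ψ with hT
  set D := (torusFormSetting F a m2 C a₀ p i).covDiffSq ψ with hDdef
  set D0 := (regularFormSetting F a m2 C a₀ p (chart₀ i)).covDiffSq ψ with hD0
  set D1 := (regularFormSetting F a m2 C a₀ p (chart₁ i)).covDiffSq
    (ψ ∘ (σYι ι i.P (fun _ => 1) i.hΩ i.hP).symm) with hD1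
  change γ₀ * (D0 + m2 * (ψ ⬝ᵥ ψ)) - C' * i.e ^ ((2 : ℝ) - α) * (ψ ⬝ᵥ ψ)
    ≤ (regularFormSetting F a m2 C a₀ p (chart₀ i)).form ψ at h0
  rw [hl2] at h1
  change γ₀ * (D1 + m2 * (ψ ⬝ᵥ ψ)) - C' * i.e ^ ((2 : ℝ) - α) * (ψ ⬝ᵥ ψ)
    ≤ (regularFormSetting F a m2 C a₀ p (chart₁ i)).form (ψ ∘ (σYι ι i.P (fun _ => 1) i.hΩ i.hP).symm) at h1
  change γ₀ / 2 * (D + m2 * (ψ ⬝ᵥ ψ)) - C' * i.e ^ ((2 : ℝ) - α) * (ψ ⬝ᵥ ψ) ≤ T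
  have hS : 0 ≤ ψ ⬝ᵥ ψ := dotProduct_self_nonneg' ψ
  have hmS : 0 ≤ m2 * (ψ ⬝ᵥ ψ) := mul_nonneg hm hS
  have hDD : γ₀ / 2 * D ≤ γ₀ / 2 * (D0 + D1) := mul_le_mul_of_nonneg_left hD (half_pos hγ₀).le
  have hMM : γ₀ / 2 * (m2 * (ψ ⬝ᵥ ψ)) ≤ γ₀ * (m2 * (ψ ⬝ᵥ ψ)) := by nlinarith
  nlinarith [h0, h1, hf0, hf1, hDD, hMM]

/-- «Proposition 3.1′ of [2]» on the torus family FOR THE PRINTED LINK VARIABLES (1.2) `U(A) = e^{qeηA}`, ANY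
antisymmetric `q` (the flow hypothesis discharged by `B4Eq12ExpFlow.expFlow_lipschitz`). [cite: Balaban1983RegularityDecay, (1.2) p.572; Prop. 3.1′ of [2] (1.21)–(1.22) p.574] -/
theorem prop31Printed_torusRegions_exp (q : Matrix ι ι ℝ) (hq : qᵀ = -q) {a : ℝ} (ha : 0 < a) {m2 : ℝ}
    (hm : 0 ≤ m2) {C : ℝ} (hC : 0 ≤ C) {a₀ : ℝ} (ha₀ : 0 ≤ a₀) {p : ℝ} (hp : 0 < p) :
    B4.Prop31Printed (torusFormSetting (d := d) (expFlow q hq) a m2 C a₀ p) :=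
  prop31Printed_torusRegions (expFlow q hq) (expFlow_ell_nonneg q) (expFlow_lipschitz q hq) ha hm hC ha₀ hp

end Main

/-! ## §4. Non-vacuity; the b4 leaf with all three η-level families on the torus -/

section NonVacuity

/-- **NON-VACUITY OF THE TORUS FAMILY**: for every threshold `e₁ > 0` the family `torusFormSetting F a m² C a₀ p`
(`C, a₀ ≥ 0`) has a member whose antecedents `unitBlocks`, `reg121` (1.21), `0 < e ≤ e₁` hold — the zero field on one
unit block of the torus `(ℤ/3)^{d+1}`, mesh `1`, charge `min e₁ 1`. [cite: Balaban1983RegularityDecay, Prop. 3.1′ of [2] (1.21) p.574 «for e sufficiently small», dictionary] -/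
theorem torus_antecedents_met (F : OrthFlow ι) (a m2 : ℝ) {C a₀ : ℝ} (hC : 0 ≤ C) (ha₀ : 0 ≤ a₀) (p : ℝ)
    {e₁ : ℝ} (he₁ : 0 < e₁) :
    ∃ i : TorusFormInstance d,
      (torusFormSetting (d := d) F a m2 C a₀ p i).unitBlocks ∧
      (torusFormSetting (d := d) F a m2 C a₀ p i).reg121 ∧
      0 < (torusFormSetting (d := d) F a m2 C a₀ p i).e ∧
      (torusFormSetting (d := d) F a m2 C a₀ p i).e ≤ e₁ := by
  have h0 : (0 : Fin (d + 1) → ℤ) ∈ boxDom (fun _ : Fin (d + 1) => 3) :=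
    mem_boxDom.2 fun _ => ⟨le_rfl, by norm_num⟩
  let i : TorusFormInstance d :=
    { n := 1
      hn := le_rfl
      P := fun _ => 3
      hP2 := fun _ => by norm_num
      h3 := fun _ => by show 3 ≤ 1 * 3; norm_num
      ΩT := {0}
      hΩ := Finset.singleton_subset_iff.2 h0
      e := min e₁ 1
      Ac := fun _ _ => 0 }
  have he : 0 < min e₁ 1 := lt_min he₁ one_pos
  refine ⟨i, trivial, ?_, he, min_le_left _ _⟩
  intro x _ μ ν
  change |(0 : ℝ) - 0| ≤ C * B2.pFn a₀ p (min e₁ 1) / ((1 : ℕ) : ℝ)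
  rw [sub_self, abs_zero]
  have hlog : 0 ≤ Real.log (min e₁ 1)⁻¹ := Real.log_nonneg (one_le_inv_iff₀.2 ⟨he, min_le_right _ _⟩)
  have hpFn : 0 ≤ B2.pFn a₀ p (min e₁ 1) := by
    unfold B2.pFn
    exact mul_nonneg ha₀ (Real.rpow_nonneg (by linarith) _)
  positivity

end NonVacuity

section DagLeaf

variable (F : OrthFlow ι) {ℓ₁ : ℝ} (hℓ₁ : 0 ≤ ℓ₁)
  (hLip : ∀ t (v : ι → ℝ), ((F.U t - 1) *ᵥ v) ⬝ᵥ ((F.U t - 1) *ᵥ v) ≤ (ℓ₁ * t) ^ 2 * (v ⬝ᵥ v))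
  (d' ℓ : ℕ) (hℓ : 1 ≤ ℓ) (amin aplus m2plus : ℝ) (ham : 0 < amin) (hap : amin ≤ aplus) (hm0 : 0 ≤ m2plus)
  (creg β : ℝ) (hcreg : 0 ≤ creg) (hβ : 0 < β) {a' : ℝ} (ha' : 0 < a')
  {a m2 C a₀ p : ℝ} (ha0 : 0 < a) (hm : 0 ≤ m2) (hC : 0 ≤ C) (ha₀ : 0 ≤ a₀) (hp : 0 < p) (d₅ N₅ : ℕ)

include hap hm0 hcreg hβ ha' ha0 hm hC ha₀ hp in
/-- **THE DAG LEAF `b4` IN ITS `0 ≤ α` FORM, ALL FOUR CONJUNCTS, WITH ALL THREE η-LEVEL FAMILIES ON THE TORUS**: Theorem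
p. 573 (1.9)–(1.12) on r01 g9's torus region pairs (`ThmPrintedNN (torusPairFam …)`) ∧ «Proposition 2.3 of [1]»
(1.15)–(1.20) on dag-p3 g2's torus famU (`Prop23Printed (torusFieldRegionsW …)`) ∧ «Proposition 3.1′ of [2]» (1.21)–(1.22)
ON THE TORUS famF OF THIS FILE (`Prop31Printed (torusFormSetting …)`) ∧ the Sect. 5 Theorem — the body of
`DagDischargedII.B4LeafNN` for these families; no family of record is re-pinned by this theorem.
[cite: Balaban1983RegularityDecay, Theorem (1.9)–(1.12) p.573; Prop. 2.3 of [1] (1.15)–(1.20) p.574; Prop. 3.1′ of [2] (1.21)–(1.22) p.574; Sect. 5 Theorem p.594; p.572 (torus)] -/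
theorem leafNN_torus_all :
    ThmPrintedNN (torusPairFam F d' ℓ amin aplus m2plus creg β (Kmod F hℓ₁ hLip d' ℓ hℓ amin aplus m2plus ham)) ∧
    B4.Prop23Printed (torusFieldRegionsW (d := d') F ℓ amin aplus m2plus a' creg β) ∧
    B4.Prop31Printed (torusFormSetting (d := d') F a m2 C a₀ p) ∧
    B4.Sect5ThmUniform d₅ N₅ :=
  ⟨thmPrintedNN_torusPairFam F hℓ₁ hLip d' ℓ hℓ amin aplus m2plus ham creg β hcreg hβ,
   prop23Printed_torusRegionsW (d := d') F hℓ₁ hLip hℓ ham hap hm0 ha' hcreg hβ,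
   prop31Printed_torusRegions (d := d') F hℓ₁ hLip ha0 hm hC ha₀ hp,
   sect5ThmUniform_holds d₅ N₅⟩

end DagLeaf

end

end Literature.MathematicalPhysics.QuantumFieldTheory.Balaban1983to89.B4Prop31TorusFamily
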